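import Summits.HubbardSuperconductivity.HubbardSuperconductivity.Theorems.AnisotropyChordTransferFibre3Level2Toolkit

/-!
# Route `AnisotropyChord` / H0 rotor rung: PartN35 LEMMA L2-B1 — the `ℤ²` TAIL of `Σ 1/(|p|² − a)²` (integral-free shell bound)

Tail estimate for the L-uniform bracket `S2UniformBracket` (`…Fibre3Level2Toolkit`, PORT PartN35, memo 21 §311(b)):
for `2 ≤ K ≤ N` and `0 ≤ a < 1`,

  `Σ_{p ∈ zWindow N ∖ zWindow K} 1/((p₁² + p₂²) − a)² ≤ π/(K² − a) ≤ π/((K−1)² − a)`   (`tail_sum_le`).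

Method (no integrals): shells `|p|∞ = j` (`zWindow j ∖ zWindow (j−1)`, at most four sides of `2j+1` points:
`shell_le_four_sides`); on a side, with `b² = j² − a`, the primitive `Q(t) = arctan(t/b) + bt/(b²+t²)`,
`Q' = 2b³/(b²+t²)²` decreasing, gives `1/(b²+t²)² ≤ (Q(t) − Q(t−1))/(2b³)` (mean value theorem, `step_le_prim_diff`) and
`Σ_{t=1}^{j} 1/(b²+t²)² ≤ Q(j)/(2b³)`; `arctan x ≤ π/4 + (x−1)/2` (`x ≥ 1`, mean value theorem) and elementary algebra give the
per-shell majorant `π(1/((j−1)²−a) − 1/(j²−a))` (`shell_majorant`, `j ≥ 3`), which telescopes.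
Prover seat `hubbard-h0-rotor-p3` g2; helper for stmt-HubbardSuperconductivity-19089 (`--supports`, helper class).
Nothing here proves superconductivity in the Hubbard model; helper lemmas of ONE conditional reduction (rung 19089).
Mathlib + the tree only; no sorry.
-/

set_option linter.dupNamespace false
set_option autoImplicit false

noncomputable section

open scoped BigOperators

namespace Summit.HubbardSuperconductivity.HubbardSuperconductivity.Theorems.AnisotropyChord.Transfer.Fibre3

/-! ## The arctangent primitive `Q(t) = arctan(t/b) + bt/(b²+t²)` -/

/-- `Q'(t) = 2b³/(b²+t²)²`. [folklore] -/
theorem hasDerivAt_arctan_prim (b : ℝ) (hb : 0 < b) (t : ℝ) :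
    HasDerivAt (fun s : ℝ => Real.arctan (s / b) + b * s / (b ^ 2 + s ^ 2))
      (2 * b ^ 3 / (b ^ 2 + t ^ 2) ^ 2) t := by
  have hbt : b ^ 2 + t ^ 2 ≠ 0 := by positivity
  have hb0 : b ≠ 0 := hb.ne'
  have h1 : HasDerivAt (fun s : ℝ => Real.arctan (s / b)) (1 / (1 + (t / b) ^ 2) * (1 / b)) t :=
    ((hasDerivAt_id' t).div_const b).arctan
  have hnum : HasDerivAt (fun s : ℝ => b * s) (b * 1) t := (hasDerivAt_id t).const_mul b
  have hden : HasDerivAt (fun s : ℝ => b ^ 2 + s ^ 2) ((2 : ℕ) * t ^ (2 - 1)) t :=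
    (hasDerivAt_pow 2 t).const_add (b ^ 2)
  have h2 := hnum.div hden hbt
  have h := h1.add h2
  refine h.congr_deriv ?_
  push_cast
  simp only [pow_one]
  field_simp
  ring

/-- one step of the integral-free comparison: for `t ≥ 1`, `1/(b²+t²)² ≤ (Q(t) − Q(t−1))/(2b³)`. [folklore] -/
theorem step_le_prim_diff (b : ℝ) (hb : 0 < b) (t : ℝ) (ht : 1 ≤ t) :
    1 / (b ^ 2 + t ^ 2) ^ 2
      ≤ ((Real.arctan (t / b) + b * t / (b ^ 2 + t ^ 2))
          - (Real.arctan ((t - 1) / b) + b * (t - 1) / (b ^ 2 + (t - 1) ^ 2))) / (2 * b ^ 3) := by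
  have hder : ∀ s : ℝ, HasDerivAt (fun s : ℝ => Real.arctan (s / b) + b * s / (b ^ 2 + s ^ 2))
      (2 * b ^ 3 / (b ^ 2 + s ^ 2) ^ 2) s := fun s => hasDerivAt_arctan_prim b hb s
  obtain ⟨c, hc, hcd⟩ := exists_hasDerivAt_eq_slope
    (fun s : ℝ => Real.arctan (s / b) + b * s / (b ^ 2 + s ^ 2)) (fun s => 2 * b ^ 3 / (b ^ 2 + s ^ 2) ^ 2)
    (by linarith : t - 1 < t) (fun s _ => (hder s).continuousAt.continuousWithinAt) (fun s _ => hder s)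
  have hc0 : 0 ≤ c := by linarith [hc.1]
  have hct : c ≤ t := hc.2.le
  have hb3 : 0 < 2 * b ^ 3 := by positivity
  have key : 2 * b ^ 3 / (b ^ 2 + t ^ 2) ^ 2 ≤ 2 * b ^ 3 / (b ^ 2 + c ^ 2) ^ 2 := by
    apply div_le_div_of_nonneg_left hb3.le (by positivity)
    have hc2 : c ^ 2 ≤ t ^ 2 := by nlinarith
    nlinarith [sq_nonneg b]
  rw [hcd, show t - (t - 1) = 1 by ring, div_one] at key
  calc 1 / (b ^ 2 + t ^ 2) ^ 2 = (2 * b ^ 3 / (b ^ 2 + t ^ 2) ^ 2) / (2 * b ^ 3) := by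
        field_simp
    _ ≤ _ := div_le_div_of_nonneg_right key hb3.le

/-- summing the steps: `Σ_{t=1}^{j} 1/(b²+t²)² ≤ Q(j)/(2b³)`. [folklore] -/
theorem sum_inv_sq_le_prim (b : ℝ) (hb : 0 < b) (j : ℕ) :
    ∑ s ∈ Finset.range j, 1 / (b ^ 2 + ((s : ℝ) + 1) ^ 2) ^ 2
      ≤ (Real.arctan ((j : ℝ) / b) + b * (j : ℝ) / (b ^ 2 + (j : ℝ) ^ 2)) / (2 * b ^ 3) := by
  set Q : ℕ → ℝ := fun s => Real.arctan ((s : ℝ) / b) + b * (s : ℝ) / (b ^ 2 + (s : ℝ) ^ 2) with hQ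
  have step : ∀ s ∈ Finset.range j, 1 / (b ^ 2 + ((s : ℝ) + 1) ^ 2) ^ 2 ≤ (Q (s + 1) - Q s) / (2 * b ^ 3) := by
    intro s _
    have h := step_le_prim_diff b hb ((s : ℝ) + 1) (by have := s.cast_nonneg (α := ℝ); linarith)
    simp only [hQ, add_sub_cancel_right, Nat.cast_add, Nat.cast_one] at h ⊢
    exact h
  calc ∑ s ∈ Finset.range j, 1 / (b ^ 2 + ((s : ℝ) + 1) ^ 2) ^ 2
      ≤ ∑ s ∈ Finset.range j, (Q (s + 1) - Q s) / (2 * b ^ 3) := Finset.sum_le_sum step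
    _ = (Q j - Q 0) / (2 * b ^ 3) := by rw [← Finset.sum_div, Finset.sum_range_sub]
    _ = _ := by simp [hQ]

/-- `arctan x ≤ π/4 + (x − 1)/2` for `x ≥ 1` (tangent at `1` of the concave arctangent). [folklore] -/
theorem arctan_le_quarter_pi_add (x : ℝ) (hx : 1 ≤ x) : Real.arctan x ≤ Real.pi / 4 + (x - 1) / 2 := by
  rcases hx.eq_or_lt with h | h
  · rw [← h, Real.arctan_one]
    simp
  · obtain ⟨c, hc, hcd⟩ := exists_hasDerivAt_eq_slope Real.arctan (fun y => 1 / (1 + y ^ 2)) h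
      Real.continuous_arctan.continuousOn (fun y _ => Real.hasDerivAt_arctan y)
    have hc1 : 1 < c := hc.1
    have hx1 : 0 < x - 1 := by linarith
    have e : Real.arctan x - Real.arctan 1 = (x - 1) * (1 / (1 + c ^ 2)) := by
      rw [hcd]; field_simp
    have hb : 1 / (1 + c ^ 2) ≤ 1 / 2 := by
      rw [div_le_div_iff₀ (by positivity) (by norm_num)]
      nlinarith
    rw [Real.arctan_one] at e
    nlinarith [mul_le_mul_of_nonneg_left hb hx1.le]

/-! ## The per-shell real inequality -/

/-- for `j ≥ 3`, `0 ≤ a < 1`, `b = √(j² − a)`: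
`4/b⁴ + 4·Q(j)/b³ ≤ π(1/((j−1)² − a) − 1/(j² − a))`. [folklore] -/
theorem shell_majorant_real (j : ℕ) (hj : 3 ≤ j) (a : ℝ) (ha0 : 0 ≤ a) (ha1 : a < 1) :
    4 / (Real.sqrt (((j : ℝ)) ^ 2 - a)) ^ 4
        + 4 * (Real.arctan ((j : ℝ) / Real.sqrt (((j : ℝ)) ^ 2 - a))
            + Real.sqrt (((j : ℝ)) ^ 2 - a) * (j : ℝ) / ((Real.sqrt (((j : ℝ)) ^ 2 - a)) ^ 2 + (j : ℝ) ^ 2))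
          / (Real.sqrt (((j : ℝ)) ^ 2 - a)) ^ 3
      ≤ Real.pi * (1 / (((j : ℝ) - 1) ^ 2 - a) - 1 / ((j : ℝ) ^ 2 - a)) := by
  have hj3 : (3 : ℝ) ≤ j := by exact_mod_cast hj
  set u : ℝ := (j : ℝ) - 1 with hu
  have hu2 : 2 ≤ u := by rw [hu]; linarith
  have hupos : 0 < u := by linarith
  have hja : 0 < (j : ℝ) ^ 2 - a := by nlinarith
  set b : ℝ := Real.sqrt ((j : ℝ) ^ 2 - a) with hb
  have hb2 : b ^ 2 = (j : ℝ) ^ 2 - a := by rw [hb]; exact Real.sq_sqrt hja.le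
  have hbpos : 0 < b := by rw [hb]; exact Real.sqrt_pos.mpr hja
  have hbu : u < b := by nlinarith [sq_nonneg (b - u), sq_nonneg (b + u)]
  have hbj : b ≤ j := by nlinarith [sq_nonneg (b - j), sq_nonneg (b + j)]
  have hc : 0 < u ^ 2 - a := by nlinarith
  have hcle : u ^ 2 - a ≤ u ^ 2 := by linarith
  have hpi3 : (3 : ℝ) ≤ Real.pi := Real.pi_gt_three.le
  have hjb : (j : ℝ) - b = a / ((j : ℝ) + b) := by
    rw [eq_div_iff (by positivity)]
    nlinarith [hb2]
  have hjb_le : (j : ℝ) - b ≤ 1 / (2 * u) := by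
    rw [hjb, div_le_div_iff₀ (by positivity) (by positivity)]
    nlinarith
  have t1 : 4 / b ^ 4 ≤ (4 / u ^ 2) / b ^ 2 := by
    rw [div_div, div_le_div_iff₀ (by positivity) (by positivity)]
    have : u ^ 2 * b ^ 2 ≤ b ^ 4 := by nlinarith [sq_nonneg b, mul_pos hupos hbpos]
    nlinarith
  have hjb1 : 1 ≤ (j : ℝ) / b := by rw [le_div_iff₀ hbpos]; linarith
  have hat := arctan_le_quarter_pi_add ((j : ℝ) / b) hjb1
  have t2 : 4 * Real.arctan ((j : ℝ) / b) / b ^ 3 ≤ (Real.pi / u + 1 / u ^ 2) / b ^ 2 := by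
    have e1 : 4 * Real.arctan ((j : ℝ) / b) ≤ Real.pi + 2 * ((j : ℝ) - b) / b := by
      have : (j : ℝ) / b - 1 = ((j : ℝ) - b) / b := by field_simp
      rw [this] at hat
      have h4 := mul_le_mul_of_nonneg_left hat (by norm_num : (0 : ℝ) ≤ 4)
      calc 4 * Real.arctan ((j : ℝ) / b) ≤ 4 * (Real.pi / 4 + ((j : ℝ) - b) / b / 2) := h4
        _ = Real.pi + 2 * ((j : ℝ) - b) / b := by ring
    have e2 : Real.pi / b ≤ Real.pi / u := div_le_div_of_nonneg_left (by positivity) hupos hbu.le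
    have e3 : 2 * ((j : ℝ) - b) / b ^ 2 ≤ 1 / u ^ 2 := by
      rw [div_le_div_iff₀ (by positivity) (by positivity)]
      have h5 : 2 * ((j : ℝ) - b) ≤ 1 / u := by
        calc 2 * ((j : ℝ) - b) ≤ 2 * (1 / (2 * u)) := by linarith
          _ = 1 / u := by field_simp
      have h6 : 2 * ((j : ℝ) - b) * u ^ 2 ≤ u := by
        have := mul_le_mul_of_nonneg_right h5 (by positivity : (0 : ℝ) ≤ u ^ 2)
        calc 2 * ((j : ℝ) - b) * u ^ 2 ≤ 1 / u * u ^ 2 := this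
          _ = u := by field_simp
      nlinarith [mul_pos hupos hbpos]
    calc 4 * Real.arctan ((j : ℝ) / b) / b ^ 3 ≤ (Real.pi + 2 * ((j : ℝ) - b) / b) / b ^ 3 :=
          div_le_div_of_nonneg_right e1 (by positivity)
      _ = (Real.pi / b + 2 * ((j : ℝ) - b) / b ^ 2) / b ^ 2 := by field_simp
      _ ≤ (Real.pi / u + 1 / u ^ 2) / b ^ 2 := div_le_div_of_nonneg_right (add_le_add e2 e3) (by positivity)
  have t3 : 4 * (b * (j : ℝ) / (b ^ 2 + (j : ℝ) ^ 2)) / b ^ 3 ≤ (2 / u) / b ^ 2 := by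
    have e4 : 4 * (j : ℝ) / (b ^ 2 + (j : ℝ) ^ 2) ≤ 2 / u := by
      rw [div_le_div_iff₀ (by positivity) hupos]
      nlinarith [hb2]
    calc 4 * (b * (j : ℝ) / (b ^ 2 + (j : ℝ) ^ 2)) / b ^ 3 = (4 * (j : ℝ) / (b ^ 2 + (j : ℝ) ^ 2)) / b ^ 2 := by
          field_simp
      _ ≤ (2 / u) / b ^ 2 := div_le_div_of_nonneg_right e4 (by positivity)
  have num : 4 / u ^ 2 + (Real.pi / u + 1 / u ^ 2) + 2 / u ≤ Real.pi * (2 * u + 1) / u ^ 2 := by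
    have e : 4 / u ^ 2 + (Real.pi / u + 1 / u ^ 2) + 2 / u = ((Real.pi + 2) * u + 5) / u ^ 2 := by
      field_simp
      ring
    rw [e, div_le_div_iff_of_pos_right (by positivity)]
    nlinarith [mul_nonneg (sub_nonneg.2 hpi3) (sub_nonneg.2 hu2)]
  have hb2u : b ^ 2 = (u + 1) ^ 2 - a := by rw [hb2, hu]; ring
  have hb2pos : 0 < b ^ 2 := by positivity
  have rhs : Real.pi * (2 * u + 1) / u ^ 2 / b ^ 2 ≤ Real.pi * (1 / (((j : ℝ) - 1) ^ 2 - a) - 1 / ((j : ℝ) ^ 2 - a)) := by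
    rw [← hu, ← hb2]
    have e5 : 1 / (u ^ 2 - a) - 1 / b ^ 2 = (2 * u + 1) / ((u ^ 2 - a) * b ^ 2) := by
      rw [div_sub_div _ _ hc.ne' hb2pos.ne',
        div_eq_div_iff (mul_ne_zero hc.ne' hb2pos.ne') (mul_ne_zero hc.ne' hb2pos.ne')]
      rw [hb2u]
      ring
    rw [e5, div_div, mul_div_assoc]
    apply mul_le_mul_of_nonneg_left _ (by positivity)
    apply div_le_div_of_nonneg_left (by positivity) (by positivity)
    nlinarith [hbpos]
  calc 4 / b ^ 4 + 4 * (Real.arctan ((j : ℝ) / b) + b * (j : ℝ) / (b ^ 2 + (j : ℝ) ^ 2)) / b ^ 3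
      = 4 / b ^ 4 + 4 * Real.arctan ((j : ℝ) / b) / b ^ 3 + 4 * (b * (j : ℝ) / (b ^ 2 + (j : ℝ) ^ 2)) / b ^ 3 := by
        ring
    _ ≤ (4 / u ^ 2) / b ^ 2 + (Real.pi / u + 1 / u ^ 2) / b ^ 2 + (2 / u) / b ^ 2 := add_le_add (add_le_add t1 t2) t3
    _ = (4 / u ^ 2 + (Real.pi / u + 1 / u ^ 2) + 2 / u) / b ^ 2 := by ring
    _ ≤ (Real.pi * (2 * u + 1) / u ^ 2) / b ^ 2 := div_le_div_of_nonneg_right num (by positivity)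
    _ ≤ _ := rhs

/-! ## Shell sums on `ℤ²` -/

/-- the symmetric interval sum of an even function: `Σ_{t=−j}^{j} h(t) = h(0) + 2 Σ_{s<j} h(s+1)`. [folklore] -/
theorem sum_Icc_symm_even (h : ℤ → ℝ) (heven : ∀ t, h (-t) = h t) (j : ℕ) :
    ∑ t ∈ Finset.Icc (-(j : ℤ)) j, h t = h 0 + 2 * ∑ s ∈ Finset.range j, h ((s : ℤ) + 1) := by
  induction j with
  | zero => simp
  | succ j ih =>
    have hset : Finset.Icc (-((j + 1 : ℕ) : ℤ)) ((j + 1 : ℕ) : ℤ)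
        = insert (-((j : ℤ) + 1)) (insert ((j : ℤ) + 1) (Finset.Icc (-(j : ℤ)) j)) := by
      ext t
      simp only [Finset.mem_Icc, Finset.mem_insert, Nat.cast_add, Nat.cast_one]
      omega
    have h1 : (-((j : ℤ) + 1)) ∉ insert ((j : ℤ) + 1) (Finset.Icc (-(j : ℤ)) j) := by
      simp only [Finset.mem_insert, Finset.mem_Icc]
      omega
    have h2 : ((j : ℤ) + 1) ∉ Finset.Icc (-(j : ℤ)) j := by
      simp only [Finset.mem_Icc]
      omega
    rw [hset, Finset.sum_insert h1, Finset.sum_insert h2, ih, Finset.sum_range_succ, heven]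
    ring

/-- the windows are nested. [folklore] -/
theorem zWindow_mono {m n : ℕ} (h : m ≤ n) : zWindow m ⊆ zWindow n := by
  unfold zWindow
  apply Finset.erase_subset_erase
  have h' : (m : ℤ) ≤ n := by exact_mod_cast h
  exact Finset.product_subset_product (Finset.Icc_subset_Icc (by linarith) h')
    (Finset.Icc_subset_Icc (by linarith) h')

/-- a side of the square: `Σ_{p ∈ box j} [p₁ = c] F(p) = Σ_{t=−j}^{j} F(c,t)` for `c ∈ [−j, j]`. [folklore] -/
theorem sum_box_ite_fst (j : ℕ) (c : ℤ) (hc : c ∈ Finset.Icc (-(j : ℤ)) j) (F : ℤ × ℤ → ℝ) :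
    ∑ p ∈ Finset.Icc (-(j : ℤ)) j ×ˢ Finset.Icc (-(j : ℤ)) j, (if p.1 = c then F p else 0)
      = ∑ t ∈ Finset.Icc (-(j : ℤ)) j, F (c, t) := by
  rw [Finset.sum_product]
  have inner : ∀ x ∈ Finset.Icc (-(j : ℤ)) j,
      ∑ y ∈ Finset.Icc (-(j : ℤ)) j, (if (x, y).1 = c then F (x, y) else 0)
        = if x = c then ∑ y ∈ Finset.Icc (-(j : ℤ)) j, F (x, y) else 0 := by
    intro x _
    split_ifs with hx <;> simp [hx]
  rw [Finset.sum_congr rfl inner, Finset.sum_ite_eq', if_pos hc]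

/-- the other side: `Σ_{p ∈ box j} [p₂ = c] F(p) = Σ_{t=−j}^{j} F(t,c)`. [folklore] -/
theorem sum_box_ite_snd (j : ℕ) (c : ℤ) (hc : c ∈ Finset.Icc (-(j : ℤ)) j) (F : ℤ × ℤ → ℝ) :
    ∑ p ∈ Finset.Icc (-(j : ℤ)) j ×ˢ Finset.Icc (-(j : ℤ)) j, (if p.2 = c then F p else 0)
      = ∑ t ∈ Finset.Icc (-(j : ℤ)) j, F (t, c) := by
  rw [Finset.sum_product]
  refine Finset.sum_congr rfl fun x _ => ?_
  simp only
  rw [Finset.sum_ite_eq', if_pos hc]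

/-- **the shell `|p|∞ = j` is covered by four sides:**
`Σ_{p ∈ zWindow j ∖ zWindow (j−1)} 1/(|p|²−a)² ≤ 4 Σ_{t=−j}^{j} 1/((j²+t²)−a)²` (`j ≥ 1`). [folklore] -/
theorem shell_le_four_sides (j : ℕ) (hj : 1 ≤ j) (a : ℝ) :
    ∑ p ∈ zWindow j \ zWindow (j - 1), 1 / ((((p.1 : ℝ)) ^ 2 + ((p.2 : ℝ)) ^ 2) - a) ^ 2
      ≤ 4 * ∑ t ∈ Finset.Icc (-(j : ℤ)) j, 1 / ((((j : ℝ)) ^ 2 + ((t : ℝ)) ^ 2) - a) ^ 2 := by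
  set F : ℤ × ℤ → ℝ := fun p => 1 / ((((p.1 : ℝ)) ^ 2 + ((p.2 : ℝ)) ^ 2) - a) ^ 2 with hF
  set box : Finset (ℤ × ℤ) := Finset.Icc (-(j : ℤ)) j ×ˢ Finset.Icc (-(j : ℤ)) j with hbox
  set G : ℤ × ℤ → ℝ := fun p => (if p.1 = (j : ℤ) then F p else 0) + (if p.1 = -(j : ℤ) then F p else 0)
      + (if p.2 = (j : ℤ) then F p else 0) + (if p.2 = -(j : ℤ) then F p else 0) with hG
  have hF0 : ∀ p, 0 ≤ F p := fun p => by rw [hF]; positivity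
  have hG0 : ∀ p, 0 ≤ G p := by
    intro p
    have := hF0 p
    rw [hG]
    dsimp only
    split_ifs <;> linarith
  have hsub : zWindow j \ zWindow (j - 1) ⊆ box := by
    intro p hp
    rw [Finset.mem_sdiff] at hp
    exact Finset.mem_of_mem_erase hp.1
  have hdom : ∀ p ∈ zWindow j \ zWindow (j - 1), F p ≤ G p := by
    intro p hp
    simp only [zWindow, Finset.mem_sdiff, Finset.mem_erase, Finset.mem_product, Finset.mem_Icc, ne_eq,
      not_and, and_imp, Prod.ext_iff] at hp
    obtain ⟨⟨hne, ⟨h1a, h1b⟩, ⟨h2a, h2b⟩⟩, hnot⟩ := hp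
    have hside : p.1 = (j : ℤ) ∨ p.1 = -(j : ℤ) ∨ p.2 = (j : ℤ) ∨ p.2 = -(j : ℤ) := by
      by_contra hcon
      push Not at hcon
      have := hnot hne
      omega
    have hf := hF0 p
    have hi : ∀ (c : Prop) [Decidable c], 0 ≤ (if c then F p else 0) := by
      intro c _
      split_ifs <;> linarith
    rw [hG]
    dsimp only
    rcases hside with h | h | h | h
    · rw [if_pos h]
      linarith [hi (p.1 = -(j : ℤ)), hi (p.2 = (j : ℤ)), hi (p.2 = -(j : ℤ))]
    · rw [if_pos h]
      linarith [hi (p.1 = (j : ℤ)), hi (p.2 = (j : ℤ)), hi (p.2 = -(j : ℤ))]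
    · rw [if_pos h]
      linarith [hi (p.1 = (j : ℤ)), hi (p.1 = -(j : ℤ)), hi (p.2 = -(j : ℤ))]
    · rw [if_pos h]
      linarith [hi (p.1 = (j : ℤ)), hi (p.1 = -(j : ℤ)), hi (p.2 = (j : ℤ))]
  have hjmem : (j : ℤ) ∈ Finset.Icc (-(j : ℤ)) j := by simp
  have hjmem' : -(j : ℤ) ∈ Finset.Icc (-(j : ℤ)) j := by simp
  have hsides : ∑ p ∈ box, G p = 4 * ∑ t ∈ Finset.Icc (-(j : ℤ)) j, F ((j : ℤ), t) := by
    rw [hG]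
    simp only [Finset.sum_add_distrib]
    rw [hbox, sum_box_ite_fst j _ hjmem, sum_box_ite_fst j _ hjmem', sum_box_ite_snd j _ hjmem,
      sum_box_ite_snd j _ hjmem']
    have e1 : ∀ t : ℤ, F (-(j : ℤ), t) = F ((j : ℤ), t) := fun t => by simp [hF]
    have e2 : ∀ t : ℤ, F (t, (j : ℤ)) = F ((j : ℤ), t) := fun t => by simp [hF, add_comm]
    have e3 : ∀ t : ℤ, F (t, -(j : ℤ)) = F ((j : ℤ), t) := fun t => by simp [hF, add_comm]
    simp only [e1, e2, e3]
    ring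
  have hside_val : ∀ t : ℤ, F ((j : ℤ), t) = 1 / ((((j : ℝ)) ^ 2 + ((t : ℝ)) ^ 2) - a) ^ 2 := by
    intro t
    simp [hF]
  calc ∑ p ∈ zWindow j \ zWindow (j - 1), F p
      ≤ ∑ p ∈ zWindow j \ zWindow (j - 1), G p := Finset.sum_le_sum hdom
    _ ≤ ∑ p ∈ box, G p := Finset.sum_le_sum_of_subset_of_nonneg hsub (fun p _ _ => hG0 p)
    _ = 4 * ∑ t ∈ Finset.Icc (-(j : ℤ)) j, F ((j : ℤ), t) := hsides
    _ = 4 * ∑ t ∈ Finset.Icc (-(j : ℤ)) j, 1 / ((((j : ℝ)) ^ 2 + ((t : ℝ)) ^ 2) - a) ^ 2 := by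
        simp only [hside_val]

/-- **per-shell majorant:** for `j ≥ 3`, `0 ≤ a < 1`:
`Σ_{p ∈ zWindow j ∖ zWindow (j−1)} 1/(|p|²−a)² ≤ π(1/((j−1)²−a) − 1/(j²−a))`. [folklore] -/
theorem shell_majorant (j : ℕ) (hj : 3 ≤ j) (a : ℝ) (ha0 : 0 ≤ a) (ha1 : a < 1) :
    ∑ p ∈ zWindow j \ zWindow (j - 1), 1 / ((((p.1 : ℝ)) ^ 2 + ((p.2 : ℝ)) ^ 2) - a) ^ 2
      ≤ Real.pi * (1 / (((j : ℝ) - 1) ^ 2 - a) - 1 / ((j : ℝ) ^ 2 - a)) := by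
  have hj3 : (3 : ℝ) ≤ j := by exact_mod_cast hj
  have hja : 0 < (j : ℝ) ^ 2 - a := by nlinarith
  set b : ℝ := Real.sqrt ((j : ℝ) ^ 2 - a) with hb
  have hb2 : b ^ 2 = (j : ℝ) ^ 2 - a := by rw [hb]; exact Real.sq_sqrt hja.le
  have hbpos : 0 < b := by rw [hb]; exact Real.sqrt_pos.mpr hja
  have h4 := shell_le_four_sides j (by omega) a
  have heven := sum_Icc_symm_even (fun t : ℤ => 1 / ((((j : ℝ)) ^ 2 + ((t : ℝ)) ^ 2) - a) ^ 2)
    (fun t => by simp) j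
  have hsum := sum_inv_sq_le_prim b hbpos j
  have hreal := shell_majorant_real j hj a ha0 ha1
  rw [← hb] at hreal
  have e0 : 1 / ((((j : ℝ)) ^ 2 + ((0 : ℤ) : ℝ) ^ 2) - a) ^ 2 = 1 / b ^ 4 := by
    rw [show b ^ 4 = (b ^ 2) ^ 2 by ring, hb2, Int.cast_zero]
    ring
  have e1 : ∀ s : ℕ, 1 / ((((j : ℝ)) ^ 2 + ((((s : ℤ) + 1 : ℤ)) : ℝ) ^ 2) - a) ^ 2
      = 1 / (b ^ 2 + ((s : ℝ) + 1) ^ 2) ^ 2 := by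
    intro s
    rw [hb2, Int.cast_add, Int.cast_natCast, Int.cast_one]
    ring
  rw [e0] at heven
  simp only [e1] at heven
  calc ∑ p ∈ zWindow j \ zWindow (j - 1), 1 / ((((p.1 : ℝ)) ^ 2 + ((p.2 : ℝ)) ^ 2) - a) ^ 2
      ≤ 4 * ∑ t ∈ Finset.Icc (-(j : ℤ)) j, 1 / ((((j : ℝ)) ^ 2 + ((t : ℝ)) ^ 2) - a) ^ 2 := h4
    _ = 4 * (1 / b ^ 4 + 2 * ∑ s ∈ Finset.range j, 1 / (b ^ 2 + ((s : ℝ) + 1) ^ 2) ^ 2) := by rw [heven]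
    _ ≤ 4 * (1 / b ^ 4 + 2 * ((Real.arctan ((j : ℝ) / b) + b * (j : ℝ) / (b ^ 2 + (j : ℝ) ^ 2)) / (2 * b ^ 3))) := by
        gcongr
    _ = 4 / b ^ 4 + 4 * (Real.arctan ((j : ℝ) / b) + b * (j : ℝ) / (b ^ 2 + (j : ℝ) ^ 2)) / b ^ 3 := by
        field_simp
    _ ≤ _ := hreal

/-- **TAIL BOUND (telescoped):** for `2 ≤ K ≤ N`, `0 ≤ a < 1`:
`Σ_{p ∈ zWindow N ∖ zWindow K} 1/(|p|²−a)² ≤ π(1/(K²−a) − 1/(N²−a))`. [folklore] -/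
theorem tail_sum_le_telescope (K : ℕ) (hK : 2 ≤ K) (a : ℝ) (ha0 : 0 ≤ a) (ha1 : a < 1) :
    ∀ N : ℕ, K ≤ N →
      ∑ p ∈ zWindow N \ zWindow K, 1 / ((((p.1 : ℝ)) ^ 2 + ((p.2 : ℝ)) ^ 2) - a) ^ 2
        ≤ Real.pi * (1 / ((K : ℝ) ^ 2 - a) - 1 / ((N : ℝ) ^ 2 - a)) := by
  refine Nat.le_induction ?_ ?_
  · simp
  · intro N hKN ih
    set F : ℤ × ℤ → ℝ := fun p => 1 / ((((p.1 : ℝ)) ^ 2 + ((p.2 : ℝ)) ^ 2) - a) ^ 2 with hF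
    have s1 : zWindow K ⊆ zWindow N := zWindow_mono hKN
    have s2 : zWindow N ⊆ zWindow (N + 1) := zWindow_mono (Nat.le_succ N)
    have s3 : zWindow K ⊆ zWindow (N + 1) := s1.trans s2
    have d1 := Finset.sum_sdiff s1 (f := F)
    have d2 := Finset.sum_sdiff s2 (f := F)
    have d3 := Finset.sum_sdiff s3 (f := F)
    have split : ∑ p ∈ zWindow (N + 1) \ zWindow K, F p
        = ∑ p ∈ zWindow (N + 1) \ zWindow N, F p + ∑ p ∈ zWindow N \ zWindow K, F p := by linarith
    have hshell := shell_majorant (N + 1) (by omega) a ha0 ha1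
    rw [Nat.add_sub_cancel] at hshell
    rw [split]
    push_cast at hshell ⊢
    have e : ((N : ℝ) + 1 - 1) = N := by ring
    rw [e] at hshell
    linarith [hshell, ih]

/-- **TAIL BOUND:** for `2 ≤ K ≤ N`, `0 ≤ a < 1`: `Σ_{p ∈ zWindow N ∖ zWindow K} 1/(|p|²−a)² ≤ π/((K−1)²−a)`
(the `ℤ²` tail constant of PartN35's `xi2hi`, with `a = νπ²/4`). [folklore] -/
theorem tail_sum_le (K N : ℕ) (hK : 2 ≤ K) (hKN : K ≤ N) (a : ℝ) (ha0 : 0 ≤ a) (ha1 : a < 1) :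
    ∑ p ∈ zWindow N \ zWindow K, 1 / ((((p.1 : ℝ)) ^ 2 + ((p.2 : ℝ)) ^ 2) - a) ^ 2
      ≤ Real.pi / (((K : ℝ) - 1) ^ 2 - a) := by
  have h := tail_sum_le_telescope K hK a ha0 ha1 N hKN
  have hK2 : (2 : ℝ) ≤ K := by exact_mod_cast hK
  have hN2 : (2 : ℝ) ≤ N := by exact_mod_cast hK.trans hKN
  have h1 : 0 ≤ 1 / ((N : ℝ) ^ 2 - a) := by
    apply div_nonneg zero_le_one
    nlinarith
  have hpos : 0 < ((K : ℝ) - 1) ^ 2 - a := by nlinarith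
  have h2 : 1 / ((K : ℝ) ^ 2 - a) ≤ 1 / (((K : ℝ) - 1) ^ 2 - a) :=
    one_div_le_one_div_of_le hpos (by nlinarith)
  calc _ ≤ Real.pi * (1 / ((K : ℝ) ^ 2 - a) - 1 / ((N : ℝ) ^ 2 - a)) := h
    _ ≤ Real.pi * (1 / (((K : ℝ) - 1) ^ 2 - a)) := by
        apply mul_le_mul_of_nonneg_left _ Real.pi_pos.le
        linarith
    _ = Real.pi / (((K : ℝ) - 1) ^ 2 - a) := by ring

end Summit.HubbardSuperconductivity.HubbardSuperconductivity.Theorems.AnisotropyChord.Transfer.Fibre3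

end
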